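import Summits.ABC.Harvest.ConsecutiveABC
import HarnessLib

/-!
# Door shim: `Summit.ABC.Harvest.ConsecutiveABC` made importable by route files

Route files (`Summits/ABC/ABC/Theses/*.lean`) may import only Mathlib / Literature / HarnessLib /
`Summits.ABC.Statement` / `Summits.ABC.ABC.Theorems.*` (gate rule), not `Summits.ABC.Harvest.*`; a route
re-filed at the rung CONS (`--closes-target CONS`, alt-closer decl `Summit.ABC.Harvest.ConsecutiveABC`,
G-29 ★ p573323) therefore needs a `Theorems` module that transitively imports the door. This file is that
shim; its one theorem is the (already proved) edge `ABC → ConsecutiveABC`, restated under the Theorems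
namespace so the file is a genuine sorry-free Theorems file. No conjecture is proved here; CONS is NOT abc.
-/

namespace Summit.ABC.ABC.Theorems

/-- The summit implies the CONS door (re-export of `Summit.ABC.Harvest.consecutiveABC_of_abc`). -/
theorem consecutiveABC_door_of_abc (h : _root_.ABC) : Summit.ABC.Harvest.ConsecutiveABC :=
  Summit.ABC.Harvest.consecutiveABC_of_abc h

/-- The CONS door in Pasten's `∃ c` form follows as well (re-export). -/
theorem consecutiveRadicalBound_door_of_abc (h : _root_.ABC) : Summit.ABC.Harvest.ConsecutiveRadicalBound :=
  Summit.ABC.Harvest.consecutiveRadicalBound_of_abc h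

end Summit.ABC.ABC.Theorems
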